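import Summits.FinalStateConjecture.FinalStateConjecture.Theses.PhaseMixingCapture
import Summits.FinalStateConjecture.FinalStateConjecture.Theorems.CaptureSufficesTame.Negative.CounterexampleShape
import Summits.FinalStateConjecture.FinalStateConjecture.Theorems.PhaseMixingCaptureCaptureSufficesC2DiagonalReduction

/-!
# Disproof of `CaptureSufficesTame` — findings (cdisprove seat, crux `stmt-FinalStateConjecture-17270`,
# route `PhaseMixingCapture`, rank 6; cycle 1, 2026-08-17)

Standing adversary's work file for
`CaptureSufficesTame := NearExtremalKappaCapture → BulkKerrCaptureC2 → WeakCosmicCensorshipTame →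
FinalStateConjecture` (the large-data front end as ONE typed conditional; re-typed successor of
`CaptureSufficesC2` after the statement revision p126844 — TAME genericity, honest radii,
`IsFutureOriented`, `RaysStayInClosure`). Prose lives in docstrings; everything below is `lean check`ed,
rc 0, no `sorry`. It EXTENDS (never restates) the landed negative files
`Theorems/CaptureSufficesTame/Negative/CounterexampleShape.lean` (refuter one-shot, p131598) and the
predecessors `Cruxes/CaptureSuffices{,C2}/Disproof.lean`, `Theorems/CaptureSuffices{,C2}/Negative/*`.

## Verdict (cycle 1): the crux RESISTS refutation — structurally (§0), and no junk route exists (§2)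

* (§0, landed) `¬ CaptureSufficesTame ↔ NearExtremalKappaCapture ∧ BulkKerrCaptureC2 ∧
  WeakCosmicCensorshipTame ∧ ¬ FinalStateConjecture` (`Negative.not_captureSufficesTame_iff`); modulo the
  two capture hypotheses the crux is EXACTLY `WeakCosmicCensorshipTame ↔ FinalStateConjecture`
  (`Negative.captureSufficesTame_iff_censorship_iff_summit`); every counterexample is an admissible,
  TAME-censored vacuum datum with a maximal development admitting no honest sub-extremal `C²` final-state
  decomposition (`Negative.not_captureSufficesTame_witness`) — an MGHD nobody can construct in the tree
  (MGHD existence is the undischarged named fact `choquetBruhat_geroch_exists_mghd_cauchy`; no development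
  is proved maximal; the exact-Kerr bookkeeping of `PhotonSphereChannelsTameCensorshipExactKerr*` runs
  modulo leaf-maximality F_B1) and nobody has in print (no censored non-settling vacuum world is known).
* (§1) No hypothesis admits a `_false_without_` theorem: dropping any one leaves a summit-implied
  statement, and the NEGATION of any one proves the crux (`example`s). `h₃` is necessary
  (`tameCensorship_of_finalStateConjecture`, landed); `h₁`, `h₂` are idle as typed (adversarial
  `∃`-packages, `CaptureSuffices.Negative.AdversarialWitnesses`; unpinned chart, `CaptureSufficesC2.Negative.
  ChartForm` / `ReversedKerrChart`) — unchanged by the re-typing, which touched `h₃` and the conclusion only.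
* (§2) JUNK HUNT on what the re-typing added. (a) TAME genericity cannot be satisfied by burial /
  receding-support witnesses (that was the point of T2) and cannot be trivially REFUTED either: through
  every admissible datum passes a tame, injective, immersed admissible curve (`exists_tame_selfWitness`,
  breathing curves — isometric copies, so they never leave a diffeomorphism-invariant exceptional set:
  self-witnesses discharge only the "base datum already good" branch of a relative argument). (b) The
  re-typed decomposition is not junk-satisfiable at `k = 2` and not even at `k = 0`: `deviationCk … 0`
  is the sup over the slab of the FULL pulled-back `4`-tensor `Ψ^* g − g₀` (transverse components
  included) and the slabs foliate the open late region, so `C⁰`-convergence of a chart is equidimensional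
  `C⁰`-approximate isometry on open sets — rigid (no Nash–Kuiper corrugation: that flexibility is
  codimension `≥ 1` only); fake Kerr zones planted in flat / far regions, or charts winding in time, are
  excluded already at `C⁰` by the transverse components, and at `C²` by curvature. (c) `N ≥ 2` slowly
  separating configurations (parabolic escape, separation `∝ τ^{2/3}`, equal asymptotic velocities) ARE
  representable (one shared motion, overlapping growing near zones cover the common excision tube), so the
  typed summit does not spuriously exclude marginally bound final states. Desk checks, recorded as prose;
  nothing here is refutable in Lean without an MGHD.
* (§3, NEW, LANDED p133675 + p133982) **TAME Christodoulou genericity is not closed under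
  conjunction** — the natural strengthening of every transfer on file ("prove the dynamical layer
  POINTWISE tame-generically and intersect with `h₃`") is not available as logic:
  `not_isTameChristodoulouGeneric_and_closed` (`Theorems/CaptureSufficesTame/Negative/TameGenericityModel.lean`
  + `TameGenericityAndFails.lean`; model on the Minkowski slice: bumped `k`-families are tame on
  `trivialAFEnd.restrict _`, immersed, injective; IVT trap through `trivialData`; rc 0, 0 sorry, standard
  axioms). So `h₃` enters ONLY by composition along curves (`isTameChristodoulouGeneric_of_relative`): the
  relative (whole-family) form of the registered stubs `stub_quietAlongCensoredCurves`,
  `stub_marginAlongQuietCurves` and of the card's `RelativeThirdLaw` is forced, not a style choice.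
* (§4) The extremal member is NOT a counterexample: exactly extremal Kerr-outside data fail the pointwise
  property (asymptotics pin `(Mᵢ, aᵢ) = (M, M)`, not sub-extremal) but sit on an analytic curve of
  sub-extremal parameters through `(M, M)` (`exists_subextremal_curve_through_extremal`, parameter level;
  the data-level curve `c ↦ Kerr(M + σ, M + σ − σ²/M)`-outside data needs the gluing fact of
  `KerrShieldedDataExist`). Only TAME-GENERIC extremal parking kills — none in print (Kehle–Unger 2025 /
  Angelopoulos–Kehle–Unger 2024/2026: extremal formation is threshold, codimension ≥ 1, in symmetry).

## §5 Pre-targets for the lines in play (no line PICKED yet; recorded for triage / the lead)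
* Card `only-the-third-law-is-generic` (`Ideas/`, `SketchIdeator2.lean`): its `ThirdLawProperty` quantifies
  over HONEST `k = 0` decompositions and asks all labels `(Mᵢ, aᵢ)` to be sub-extremal. LOAD-BEARING AND
  UNSTATED: **`C⁰`-honest Kerr charts pin their label** — if some censored settled development admitted,
  next to its honest chart `Ψ → Kerr(M, a)`, a re-gauged chart `Ψ ∘ φ_τ` converging in `C⁰` to an
  EXTREMAL background `Kerr(M', M')` (a "relabelling"), then `ThirdLawProperty` would fail at every such
  datum and `RelativeThirdLaw` would be false along the constant censored curve through it. By §2(b)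
  (transverse components, open-set `C⁰` rigidity) no relabelling should exist, but the tree has no lemma
  `kerr_params_of_C0_close : (φ^* g_{M,a} → g_{M',a'} in C⁰ on growing truncated slabs) → (M', a') = (M, a)`,
  and the card cannot dodge the question by raising `k` (its cut is `C⁰` precisely because `C¹` convergence
  to an extremal hole is Aretakis-obstructed). Cheapest exposure: the `1+1` reduction (Kerr's
  `(t*, r)`-plane metrics of different `a/M` are not `C⁰`-limits of each other's isometric images on a
  bounded domain — rapidity must be locally constant, §2(b)); a proof at `k = 0` in `3+1` is a research
  lemma (low-regularity Lorentzian Myers–Steenrod), to be registered as a stub if this line is picked.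
* Line `censorship-enters-diagonally` (ported, `finalStateConjecture_of_tameLayer`): `stub_trackedCaptureSettles`
  is POINTWISE (every censored MGHD tracked at every accuracy with one complexity settles as the summit
  demands). Checked: `VacuumCauchyDevelopment.IsAdiabaticallyTracked` is typed at `k = 2` with its region
  PINNED (`O = exteriorOf (⋃ window images)`, clause (5)) and COVERED (clause (6)) and its windows EXHAUSTING
  (clause (4)), so the pre-T2 chart-placement junk (windows parked in the far / early region) is excluded and
  the stub is not print-false at exactly-extremal data (§4: honest `C²` tracking with `|aᵢ| ≤ χ Mᵢ`, `χ < 1`,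
  fails there, as it should). What the predicate does NOT carry relative to the re-typed summit: chart time
  orientation (`IsFutureOriented`) and the intrinsic lower bound `RaysStayInClosure` — both must be
  manufactured by the stub's prover (orientation by re-reversing charts, `CaptureSufficesC2.Negative.
  ReversedKerrChart`; rays from the covering clause). Work, not falsity.

## HANDOFF (cycle 1)
LANDED under `Theorems/CaptureSufficesTame/Negative/` (all ACCEPTED, importable): `CounterexampleShape.lean`
(p131598, one-shot refuter); `TameGenericityModel.lean` (p133675, this seat: `famT`, `tameClass`,
`isTameDataFamily_famT`, `isImmersedAtZero_famT_fst/snd`); `TameGenericityAndFails.lean` (p133982, this seat: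
`radial_escapeT`, `origin_escapeT`, `isTameChristodoulouGeneric_P/Q`, `not_isTameChristodoulouGeneric_P_and_Q`,
`isTameChristodoulouGeneric_and_fails`, `not_isTameChristodoulouGeneric_and_closed`). Sorried here: nothing. Not refutable in Lean: the crux (§0). Next regimes if re-armed: (i) when a line is
picked, attack its stubs' hypotheses one at a time (for `censorship-enters-diagonally`: is
`IsAdiabaticallyTracked` junk-satisfiable at coarse accuracy — then `stub_trackedCaptureSettles` carries the
whole summit pointwise; for `only-the-third-law-is-generic`: `ThirdLawProperty` quantifies over `k = 0`
decompositions — check that `C⁰` honest decompositions of an exactly sub-extremal Kerr exterior cannot carry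
an EXTREMAL label, i.e. that `(M, a)` is a `C⁰`-invariant of honest charts (§2(b) says yes for the metric,
but the LABEL is read off the background the chart is compared with: two Kerr backgrounds are not
`C⁰`-close on slabs unless their parameters agree — to be made a lemma `kerr_params_of_C0_close`);
(ii) the `N ≥ 2` receding bookkeeping of any front end (shared vs separate motions, §2(c)); (iii) literature
watch: a tame-generic extremal-parking or eternal-binary mechanism in vacuum would be the kill.
-/

-- the problem namespace `FinalStateConjecture.FinalStateConjecture` (single-conjunct summit) trips dupNamespace
set_option linter.dupNamespace false

noncomputable section

open scoped Manifold ContDiff Topology ENNReal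
open Set Function

namespace Summit.FinalStateConjecture.FinalStateConjecture.Cruxes.CaptureSufficesTame.Disproof

open Literature.Geometry.Lorentzian
open Summit.FinalStateConjecture.FinalStateConjecture.Theses.PhaseMixingCapture
  (NearExtremalKappaCapture BulkKerrCaptureC2 WeakCosmicCensorshipTame WeakCosmicCensorshipMGHD
    CaptureSufficesTame CaptureSufficesC2 Assembly)
open Summit.FinalStateConjecture.FinalStateConjecture.Theorems.CaptureSufficesTame.Negative
  (not_captureSufficesTame_iff captureSufficesTame_iff_censorship_iff_summit
    not_captureSufficesTame_witness)
open Summit.FinalStateConjecture.FinalStateConjecture.Theorems.PhaseMixingCaptureCaptureSufficesC2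
  (tameCensorship_of_finalStateConjecture weakCosmicCensorshipMGHD_of_tameCensorship)

/-! ## §0 Position (landed facts, cited) -/

/-- The shape of a disproof (landed as `Negative.not_captureSufficesTame_iff`): both capture statements,
TAME weak cosmic censorship AND a refutation of the summit. [folklore] -/
example : ¬ CaptureSufficesTame ↔
    NearExtremalKappaCapture ∧ BulkKerrCaptureC2 ∧ WeakCosmicCensorshipTame ∧
      ¬ _root_.FinalStateConjecture :=
  not_captureSufficesTame_iff

/-- The summit implies the crux (so a kill refutes the summit). [folklore] -/
theorem captureSufficesTame_of_finalStateConjecture (h : _root_.FinalStateConjecture) :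
    CaptureSufficesTame :=
  fun _ _ _ ↦ h

/-- Restates-the-target measure (landed): modulo the captures the crux is `WCCTame ↔ FSC`. [folklore] -/
example : CaptureSufficesTame ↔
    (NearExtremalKappaCapture → BulkKerrCaptureC2 →
      (WeakCosmicCensorshipTame ↔ _root_.FinalStateConjecture)) :=
  captureSufficesTame_iff_censorship_iff_summit

/-- **Bare-handed form.** The crux follows from `WeakCosmicCensorshipTame → FinalStateConjecture` (the two
capture hypotheses dropped): this is what every line on file actually proves. [folklore] -/
theorem captureSufficesTame_of_bare (h : WeakCosmicCensorshipTame → _root_.FinalStateConjecture) :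
    CaptureSufficesTame :=
  fun _ _ h₃ ↦ h h₃

/-- … and conversely, in the route's world (captures granted) the crux IS the bare-handed form. -/
theorem bare_of_captureSufficesTame (h₁ : NearExtremalKappaCapture) (h₂ : BulkKerrCaptureC2)
    (h : CaptureSufficesTame) : WeakCosmicCensorshipTame → _root_.FinalStateConjecture :=
  h h₁ h₂

/-- **Position relative to the pre-revision crux**: `CaptureSufficesC2 → CaptureSufficesTame` (the tame
censorship hypothesis is STRONGER than the plain one, `weakCosmicCensorshipMGHD_of_tameCensorship`), so the
re-typed crux is formally WEAKER than its predecessor; the converse needs `WCC_MGHD → WCCTame`, i.e. an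
upgrade of plain to tame genericity, which is false in general (burial witnesses are plain-legal, not tame).
(Positive implication record — a prover may land it; here it only fixes the direction of comparison.)
[folklore] -/
theorem captureSufficesTame_of_captureSufficesC2 (h : CaptureSufficesC2) : CaptureSufficesTame :=
  fun h₁ h₂ h₃ ↦ h h₁ h₂ (weakCosmicCensorshipMGHD_of_tameCensorship h₃)

/-! ## §1 Load-bearing analysis: no `_false_without_` theorem exists for a summit-implied conditional -/

/-- Dropping `h₃` (resp. `h₁`, `h₂`) leaves `h₁ → h₂ → FSC` (resp. …), still implied by the summit; and
the negation of any hypothesis PROVES the crux. So "any proof must use `hᵢ`" cannot be certified by a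
counterexample here — only by the restates-target measure of §0. -/
example (h : ¬ NearExtremalKappaCapture) : CaptureSufficesTame := fun h₁ ↦ (h @h₁).elim
example (h : ¬ BulkKerrCaptureC2) : CaptureSufficesTame := fun _ h₂ ↦ (h @h₂).elim
example (h : ¬ WeakCosmicCensorshipTame) : CaptureSufficesTame := fun _ _ h₃ ↦ (h h₃).elim
example (h : _root_.FinalStateConjecture) : NearExtremalKappaCapture → BulkKerrCaptureC2 →
    _root_.FinalStateConjecture := fun _ _ ↦ h

/-- `h₃` is NECESSARY (landed): the summit implies tame censorship. Hence `¬ h₃` refutes the summit and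
makes the crux vacuous at once. [folklore] -/
example (h : _root_.FinalStateConjecture) : WeakCosmicCensorshipTame :=
  fun X _ _ _ _ _ _ ↦ tameCensorship_of_finalStateConjecture h X

/-! ## §4 The extremal member is rescued at the parameter level -/

/-- **An analytic curve of SUB-extremal Kerr parameters through the extremal point `(M, M)`.** With
`σ(c) = (M/2)·(c / (1 + |c|))` (`|σ| < M/2`, injective, `σ 0 = 0`), the curve
`c ↦ (M + σ c, M + σ c − (σ c)²/M)` passes through `(M, M)` at `c = 0` and is strictly sub-extremal for
`c ≠ 0`: `|a(c)| < M(c)` and `0 < M(c)`. This is the parameter shadow of the tame rescuing curve of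
exactly-extremal Kerr-outside data (rattack note, 2026-08-16): a single extremal member is an exceptional
POINT of the settled property, not a counterexample to its tame genericity; only a tame-generic FAMILY of
parked developments would be. [folklore] -/
theorem exists_subextremal_curve_through_extremal {M : ℝ} (hM : 0 < M) :
    ∃ γ : ℝ → ℝ × ℝ, γ 0 = (M, M) ∧ Injective γ ∧
      ∀ c ≠ 0, 0 < (γ c).1 ∧ Kerr.IsSubextremal (γ c).1 (γ c).2 := by
  set σ : ℝ → ℝ := fun c ↦ M / 2 * (c / (1 + |c|)) with hσ
  have hden : ∀ c : ℝ, 0 < 1 + |c| := fun c ↦ by positivity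
  have hσbd : ∀ c, |σ c| < M / 2 := by
    intro c
    have h1 : |c / (1 + |c|)| < 1 := by
      rw [abs_div, abs_of_pos (hden c), div_lt_one (hden c)]
      linarith [abs_nonneg c]
    calc |σ c| = M / 2 * |c / (1 + |c|)| := by
          rw [hσ]; simp only; rw [abs_mul, abs_of_pos (by positivity : (0 : ℝ) < M / 2)]
      _ < M / 2 * 1 := by gcongr
      _ = M / 2 := mul_one _
  have hσ0 : ∀ c, σ c = 0 ↔ c = 0 := by
    intro c
    simp only [hσ, mul_eq_zero, div_eq_zero_iff, hM.ne', OfNat.ofNat_ne_zero, or_self, false_or,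
      (hden c).ne', or_false]
  -- injectivity of `c ↦ c / (1 + |c|)` (strictly monotone would do; we use the explicit inverse)
  have hinjφ : Injective (fun c : ℝ ↦ c / (1 + |c|)) := by
    intro c c' h
    simp only at h
    have key : ∀ {x y : ℝ}, x / (1 + |x|) = y / (1 + |y|) → 0 ≤ x → 0 ≤ y → x = y := by
      intro x y hxy hx hy
      rw [abs_of_nonneg hx, abs_of_nonneg hy, div_eq_div_iff (by positivity) (by positivity)] at hxy
      nlinarith
    have hsign : ∀ {x y : ℝ}, x / (1 + |x|) = y / (1 + |y|) → 0 ≤ x → 0 ≤ y ∨ False := by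
      intro x y hxy hx
      left
      by_contra hy
      push Not at hy
      have h1 : 0 ≤ x / (1 + |x|) := div_nonneg hx (hden x).le
      have h2 : y / (1 + |y|) < 0 := div_neg_of_neg_of_pos hy (hden y)
      linarith
    rcases le_total 0 c with hc | hc
    · rcases hsign h hc with hc' | hf
      · exact key h hc hc'
      · exact hf.elim
    · -- reduce to the non-negative case by `x ↦ -x`
      have h' : (-c) / (1 + |-c|) = (-c') / (1 + |-c'|) := by
        rw [abs_neg, abs_neg, neg_div, neg_div, h]
      have hc0 : 0 ≤ -c := by linarith
      rcases hsign h' hc0 with hc' | hf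
      · have := key h' hc0 hc'; linarith
      · exact hf.elim
  refine ⟨fun c ↦ (M + σ c, M + σ c - σ c ^ 2 / M), ?_, ?_, ?_⟩
  · simp [hσ]
  · intro c c' h
    have h1 : M + σ c = M + σ c' := congrArg Prod.fst h
    have h2 : σ c = σ c' := by linarith
    have h3 : c / (1 + |c|) = c' / (1 + |c'|) := by
      have := h2; simp only [hσ] at this
      exact mul_left_cancel₀ (by positivity : (M / 2 : ℝ) ≠ 0) this
    exact hinjφ h3
  · intro c hc
    have hs : σ c ≠ 0 := fun h ↦ hc ((hσ0 c).1 h)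
    have hb := hσbd c
    have hb' : -(M / 2) < σ c ∧ σ c < M / 2 := abs_lt.1 hb
    have hMc : 0 < M + σ c := by linarith
    refine ⟨hMc, ?_⟩
    show |M + σ c - σ c ^ 2 / M| < M + σ c
    have hsq : 0 < σ c ^ 2 / M := div_pos (by positivity) hM
    have hsq' : σ c ^ 2 / M < M / 4 := by
      have : σ c ^ 2 < (M / 2) ^ 2 := by nlinarith [hb'.1, hb'.2]
      have h4 : σ c ^ 2 / M < (M / 2) ^ 2 / M := div_lt_div_of_pos_right this hM
      have h5 : (M / 2) ^ 2 / M = M / 4 := by field_simp; ring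
      linarith
    rw [abs_lt]
    constructor <;> linarith

end Summit.FinalStateConjecture.FinalStateConjecture.Cruxes.CaptureSufficesTame.Disproof

end
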